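import Summits.NavierStokesRegularity.NavierStokesRegularity.Theses.QuantisedSymmetry
import HarnessLib.Audit

/-!
# Birth skeleton (BC3) of the crux `QuantisedSymmetry.PolyhedralTruncationBridge`

(crux item `stmt-NavierStokesRegularity-11331`, rank 4, route `route-NavierStokesRegularity-QuantisedSymmetry`;
tree path `Cruxes/PolyhedralTruncationBridge/Lines/birth.lean`; registrar
`planner-skel-stmt-NavierStokesRegularity-11331-0`, 2026-08-17. The route predates the Lean birth certificate;
this file supplies BC3 retroactively. No `Disproof.lean`, no dead lines and no other `Lines/` exist for this
crux at registration time — `ledger crux ls` showed no workfiles.)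

THE CRUX (by name, never restated): for every finite irreducible proper rotation group `G`, every `λ > 1` and
every nontrivial `G`-equivariant `λ`-DSS ancient mild solution `u` (ν = 1, measurable slices) with the Type-I
bound `‖u(t,x)‖ ≤ C₀/(‖x‖ + √−t)`, there are `ν > 0`, `T > 0` and a Leray–Hopf CLASSICAL solution `(v, p)` from a
rapidly decaying datum with finite maximal lifespan `T`
(`IsMaximalSmoothSolution ν 0 v p T ∧ IsLerayHopfOn T ν 0 (v 0) v ∧ HasRapidSpatialDecay (v 0)`).
Refuter record (10 seats, 2026-08-15): item ⟺ (`PolyhedralDssProfileExists → X5a`), implied in three lines by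
the shared sector-agnostic bridge stmt-0901; nearest print = the LOCAL / forced transfer AlbrittonBarker2019
(arXiv:1811.00502) Thm 1.1 / Rem 4.3; the unforced Schwartz-datum transfer is not in print.

THE CUT — along the seam of the route's own construction sketch (similarity variables, `G`-equivariant
Bogovskiĭ-corrected cut-off of `u(·,−T)`, finite-codimension correction of the datum absorbing the unstable
Floquet directions of the DSS orbit, the far field entering the core only against the outward drift):

* `stub_dssSingularOrigin` [S/M, TRUE — provable now; scaling]: a `λ`-DSS field (`λ > 1`) which is not a.e.
  zero on every negative slice is unbounded on EVERY backward parabolic cylinder `Q_r(0,0)`. (If `‖u‖ ≤ M` on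
  `Q_r(0,0)` then iterating `u(t,x) = λ^{-k} u(λ^{-2k}t, λ^{-k}x)` gives `‖u(t,x)‖ ≤ λ^{-k}M → 0`, so `u ≡ 0` on
  `t < 0`.) This is what makes the transferred solution singular AT A FINITE POINT, `(T, 0)`; it needs neither
  the mild nor the Type-I hypothesis.
* `stub_equivariantCoreShadowing` [XL, OPEN — the analytic heart, the per-sector transfer itself]: for the
  profile `u` (all crux hypotheses) there are `T > 0` and a classical solution `(v, p)` of NS (ν = 1) on
  `[0, T) × ℝ³`, Leray–Hopf on `[0, T)` from its own rapidly decaying `G`-equivariant datum `v 0`, which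
  SHADOWS the time-shifted profile near the prospective singular point: `‖v(t,x) − u(t − T, x)‖ ≤ M` on a
  backward cylinder `Q_r(T, 0)` with `r² ≤ T`. (The datum is the equivariant Schwartz truncation of `u(−T)`
  corrected in finitely many directions; "shadowing with bounded remainder" is the Albritton–Barker shape
  `v = u + w`, `w ∈ L^∞(Q)`, but GLOBAL from an unforced Schwartz datum — why it might fail: non-symmetry
  Floquet multipliers of the orbit may accumulate at the unit circle (far-field essential spectrum), and the
  truncated solution must not blow up elsewhere before `T`; the route's bet is that in the `G`-invariant
  isotypic component only the orbit tangent is neutral — 1 symmetry mode instead of 7.)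
* `stub_maximal_of_singularPoint` [S/M, TRUE — provable now; continuation vocabulary]: a classical solution on
  `[0, T)` that is unbounded on every backward cylinder `Q_r(T, x₀)`, `r² ≤ T`, at a FINITE point `x₀` admits no
  classical extension past `T` (an extension is jointly continuous on `[0, T′) × ℝ³ ⊃ [T − r², T] × B̄_r(x₀)`,
  a compact set), hence `IsMaximalSmoothSolution ν 0 v p T`. Blow-up "at spatial infinity only" would NOT give
  maximality in the tree's sense — this is why the cut goes through a finite singular point and stub 1.

`PolyhedralTruncationBridge_of : Theses.QuantisedSymmetry.PolyhedralTruncationBridge` is the ONLY theorem of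
this file concluding the crux (BY NAME, no `Prop` hypotheses; the three stubs used by name; placeholders only
inside the three `stub_*`). It is a real composition (≈ 40 lines): take `(T, v, p)` and the shadowing cylinder
`Q_{r₀}(T,0)`, bound `M₀` from stub 2; for a test cylinder `Q_r(T,0)` and level `M` run stub 1 at scale
`min r r₀` and level `M + M₀`, shift the witness `(t, x) ↦ (t + T, x)` into `Q_r(T,0) ∩ Q_{r₀}(T,0)` and use
`‖v‖ ≥ ‖u‖ − ‖v − u‖ > M`; stub 3 at `x₀ = 0` then gives maximality, and the crux holds with `ν = 1`.
Its CLOSED twin `PolyhedralTruncationBridge_of_hyps : <sig 1> → <sig 2> → <sig 3> → PolyhedralTruncationBridge`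
(same proof, stub statements as hypotheses, no placeholder anywhere) is the registrar's evidence file
`bc/PolyhedralTruncationBridge_birth_closed.lean`.

BC3 PROBES (registrar folder `bc/probe_*.lean`): for each stub `S`, `S → PolyhedralTruncationBridge`,
`S → NavierStokesRegularity` and `S → ¬NavierStokesRegularity` by `first | exact? | simpa | aesop` must all FAIL
(results quoted in `Lines/birth.md`). Stubs 1 and 3 are true statements, so `S → crux` is the crux itself;
stub 2 lacks maximality (no extension-exclusion can be synthesised by automation) and says nothing about the
Clay statement.
-/

noncomputable section

open Set MeasureTheory Filter Topology
open Literature.Analysis.FluidPDE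

namespace Summit.NavierStokesRegularity.NavierStokesRegularity.Cruxes.PolyhedralTruncationBridge.Birth

set_option linter.unusedVariables false
set_option linter.dupNamespace false

local notation "E3" => EuclideanSpace ℝ (Fin 3)

/-- **stub 1 — `stub_dssSingularOrigin` (S/M, true; parabolic scaling only).**
A `c`-discretely-self-similar field with `1 < c` that is not a.e. zero on every negative time slice is
unbounded on every backward parabolic cylinder `Q_r(0, 0) = (−r², 0) × B_r(0)`: the space–time origin is a
genuine (finite) singular point of the profile. Proof route: if `‖u‖ ≤ M` on `Q_r(0,0)`, then for any `t < 0`,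
`x`, iterating `nsRescale c u = u` backwards gives `u t x = c^{-k} • u (c^{-2k} t) (c^{-k} • x)` with the
argument in `Q_r(0,0)` for `k` large, so `‖u t x‖ ≤ c^{-k} M → 0`; hence `u t = 0` for all `t < 0`. -/
theorem stub_dssSingularOrigin :
    ∀ c : ℝ, 1 < c → ∀ u : ℝ → E3 → E3,
      IsDiscretelySelfSimilar c u → ¬ (∀ t < 0, u t =ᵐ[volume] 0) →
      ∀ r : ℝ, 0 < r → ∀ M : ℝ,
        ∃ z ∈ parabolicCylinder r ((0 : ℝ), (0 : E3)), M < ‖u z.1 z.2‖ := by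
  sorry

/-- **stub 2 — `stub_equivariantCoreShadowing` (XL, OPEN; the per-sector transfer = the analytic heart).**
For every finite irreducible proper rotation group `G`, every `c > 1` and every nontrivial `G`-equivariant
`c`-DSS ancient mild solution `u` (ν = 1, measurable slices, Type-I bound), there are `T > 0` and a classical
solution `(v, p)` of the unforced Navier–Stokes system (ν = 1) on `[0, T) × ℝ³` which is Leray–Hopf on `[0, T)`
from its own datum `v 0`, the datum being rapidly decaying and `G`-equivariant (the equivariant Schwartz
truncation of `u(−T)`, corrected in finitely many directions), and which shadows the time-shifted profile with
bounded remainder on a backward cylinder at the prospective singular point `(T, 0)`: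
`‖v t x − u (t − T) x‖ ≤ M` for `(t, x) ∈ Q_r(T, 0)`, `r² ≤ T`. Sources: JiaSverak2015 / JiaSverak2014 §1
(forward twin), BradshawTsai2017CPDE §5, AlbrittonBarker2019 Thm 1.1 / Rem 4.3 (local / forced transfer only),
Tsai2018 ch. 8, ChaeWolf2017RemovingDSS Thm 1.1. -/
theorem stub_equivariantCoreShadowing :
    ∀ G : Subgroup (E3 ≃ₗᵢ[ℝ] E3), Finite G →
      (∀ g ∈ G, LinearMap.det (g.toLinearEquiv : E3 →ₗ[ℝ] E3) = 1) →
      (∀ V : Submodule ℝ E3, (∀ g ∈ G, ∀ v ∈ V, g v ∈ V) → V = ⊥ ∨ V = ⊤) →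
      ∀ c : ℝ, 1 < c → ∀ u : ℝ → E3 → E3,
        IsAncientMildSolution 1 u → (∀ t < 0, AEStronglyMeasurable (u t) volume) →
        IsDiscretelySelfSimilar c u → (∃ C₀ : ℝ, HasTypeIDecay C₀ u) →
        (∀ g ∈ G, ∀ t x, u t (g x) = g (u t x)) → ¬ (∀ t < 0, u t =ᵐ[volume] 0) →
        ∃ T : ℝ, 0 < T ∧ ∃ (v : ℝ → E3 → E3) (p : ℝ → E3 → ℝ),
          IsClassicalNSSolutionOn (Set.Ico 0 T) 1 0 v p ∧ IsLerayHopfOn T 1 0 (v 0) v ∧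
          HasRapidSpatialDecay (v 0) ∧ (∀ g ∈ G, ∀ x, v 0 (g x) = g (v 0 x)) ∧
          ∃ r : ℝ, 0 < r ∧ r ^ 2 ≤ T ∧ ∃ M : ℝ,
            ∀ z ∈ parabolicCylinder r ((T : ℝ), (0 : E3)), ‖v z.1 z.2 - u (z.1 - T) z.2‖ ≤ M := by
  sorry

/-- **stub 3 — `stub_maximal_of_singularPoint` (S/M, true; Beale–Kato–Majda continuation vocabulary).**
A classical solution `(v, p)` of NS on `[0, T) × ℝ³` which is unbounded on every backward parabolic cylinder
`Q_r(T, x₀)`, `0 < r`, `r² ≤ T`, at some FINITE point `x₀` is a maximal smooth solution with lifespan `T`: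
no classical `(v′, p′)` on `[0, T′)`, `T′ > T`, agrees with `v` on `[0, T)` (such a `v′` is jointly continuous
on `[0, T′) × ℝ³`, hence bounded on the compact `[T − r², T] × B̄_r(x₀)`, where it equals `v` below `T`). -/
theorem stub_maximal_of_singularPoint :
    ∀ ν T : ℝ, 0 < T → ∀ (v : ℝ → E3 → E3) (p : ℝ → E3 → ℝ) (x₀ : E3),
      IsClassicalNSSolutionOn (Set.Ico 0 T) ν 0 v p →
      (∀ r : ℝ, 0 < r → r ^ 2 ≤ T → ∀ M : ℝ,
          ∃ z ∈ parabolicCylinder r ((T : ℝ), x₀), M < ‖v z.1 z.2‖) →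
      IsMaximalSmoothSolution ν 0 v p T := by
  sorry

/-- **Birth composition (the skeleton theorem).** The crux BY NAME from the three registered stubs, used by
name; `ν = 1`, the lifespan `T` and the solution `(v, p)` of stub 2, its singular point `(T, 0)` detected by
stub 1 through the shadowing estimate, maximality by stub 3. -/
theorem PolyhedralTruncationBridge_of : Theses.QuantisedSymmetry.PolyhedralTruncationBridge := by
  have hA := stub_dssSingularOrigin
  have hB := stub_equivariantCoreShadowing
  have hC := stub_maximal_of_singularPoint
  intro G hfin hdet hirr c hc u hanc hmeas hdss hdec heqv hnt
  obtain ⟨T, hT, v, p, hcl, hLH, hdecay, -, r₀, hr₀, hr₀T, M₀, hshadow⟩ :=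
    hB G hfin hdet hirr c hc u hanc hmeas hdss hdec heqv hnt
  refine ⟨1, one_pos, T, hT, v, p, ?_, hLH, hdecay⟩
  refine hC 1 T hT v p 0 hcl ?_
  intro r hr hrT M
  -- stub 1 at scale `min r r₀` and level `M + M₀`
  have hm : 0 < min r r₀ := lt_min hr hr₀
  obtain ⟨z, hz, hzM⟩ := hA c hc u hdss hnt (min r r₀) hm (M + M₀)
  obtain ⟨t, x⟩ := z
  simp only [mem_parabolicCylinder, zero_sub] at hz
  obtain ⟨⟨ht1, ht2⟩, hx⟩ := hz
  have hsq_r : (min r r₀) ^ 2 ≤ r ^ 2 := pow_le_pow_left₀ hm.le (min_le_left r r₀) 2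
  have hsq_r₀ : (min r r₀) ^ 2 ≤ r₀ ^ 2 := pow_le_pow_left₀ hm.le (min_le_right r r₀) 2
  -- the shifted witness `(t + T, x)` lies in both cylinders at `(T, 0)`
  have hz_r : ((t + T, x) : ℝ × E3) ∈ parabolicCylinder r ((T : ℝ), (0 : E3)) := by
    simp only [mem_parabolicCylinder]
    exact ⟨⟨by linarith, by linarith⟩, lt_of_lt_of_le hx (min_le_left r r₀)⟩
  have hz_r₀ : ((t + T, x) : ℝ × E3) ∈ parabolicCylinder r₀ ((T : ℝ), (0 : E3)) := by
    simp only [mem_parabolicCylinder]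
    exact ⟨⟨by linarith, by linarith⟩, lt_of_lt_of_le hx (min_le_right r r₀)⟩
  refine ⟨(t + T, x), hz_r, ?_⟩
  -- shadowing on `Q_{r₀}(T, 0)` and the reverse triangle inequality
  have hsh := hshadow _ hz_r₀
  simp only [add_sub_cancel_right] at hsh
  have htri : ‖u t x‖ - ‖v (t + T) x‖ ≤ ‖u t x - v (t + T) x‖ := norm_sub_norm_le _ _
  have hrev : ‖u t x - v (t + T) x‖ = ‖v (t + T) x - u t x‖ := norm_sub_rev _ _
  show M < ‖v (t + T) x‖
  linarith

end Summit.NavierStokesRegularity.NavierStokesRegularity.Cruxes.PolyhedralTruncationBridge.Birth
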